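import Literature.AlgebraicGeometry.HodgeTheory.QuaternionicQuarticDoublePlaneIntegral
import HarnessLib

/-!
# The explicit «Fermat member» of the quaternionic quartic family and its double plane in closed form

Layer `Literature/AlgebraicGeometry/HodgeTheory`, namespace `Literature.AlgebraicGeometry.HodgeTheory.Q8Family`. One definition
(`fermatParam e`, an explicit coefficient vector) + PROVED closed forms; no named fact. Written by the prover seat
`leafhand-hodge-q8symplecticpowers-4` (g5, cell `pub-hsemireg`) as the first half of target (T2) «one explicit nodal member for every
even `e`» of memo NINTH-HAND-S1-DESIGN-leafhand4-g5 for the S1 re-cut of route `HodgeConjecture/Q8SymplecticPowers` (crux K1Q,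
stmt-HodgeConjecture-24190; the assembly `Q8SymplecticPowersRegularOfNodalBranchCurve.stub_regularVeryGeneralQ_of_nodalDoubleCoverFact`
needs the nodal locus to be non-empty, and this member is the proposed witness).

The member: `c* = x₀ + 2x₂` (so `a₀ = 1, a₁ = 0, a₂ = 2`, `a₀² − a₁² = 1`, `dinv = 1`) and `ψ* = x₀^{e−1} + x₁^{e−1} + x₂^{e−1}`
(written as `ψ₀ + σ^*ψ₀` with `ψ₀ = x₀^{e−1} + ½ x₂^{e−1}`). In the plane coordinates `(s, y)` of
`QuaternionicQuarticDoublePlaneCoordinates` ∕ `…Integral`: `u₀ = s²y − 2`, `u₁ = y − 2`, `A₂ = s²y − y`,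
`Ψ₂ = (s²y − 2)^{e−1} + (y − 2)^{e−1} + 1`, and the branch form of the double plane is
`G₂ = s · (s²y − y) · Ψ₂ = s(s² − 1)·y·Ψ₂` — the configuration `E + f₀ + f₁ + f₋₁ (+ f_∞) + Ψ̃` of the S1 census, now with an
EXPLICIT `Ψ̃`. Also recorded: `Ψ₂(s, 0) = 1 − 2^e ≠ 0` (the curve `Ψ̃` misses `E = {y = 0}`), the first of the hand checks of
memo §0bis (T2). Honest scope: explicit algebra for one member; nothing here bears on HC; S1 ∕ K1Q NOT proved here.

References: [Kollar2007] §3.3 (the family); [Naie2007] §1.2 (normalization procedure) — as in the files this one extends.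
-/

noncomputable section

open MvPolynomial
open Literature.AlgebraicGeometry.Motives Literature.AlgebraicGeometry.Motives.UniversalHypersurface

namespace Literature.AlgebraicGeometry.HodgeTheory.Q8Family

variable (e : ℕ)

/-- **The Fermat member** of the parameter space: `c* = x₀ + 2x₂`, `ψ₀* = x₀^{e−1} + ½ x₂^{e−1}` (so that
`ψ* = ψ₀* + σ^*ψ₀* = x₀^{e−1} + x₁^{e−1} + x₂^{e−1}`). [cite: Kollar2007, §3.3] -/
def fermatParam : CIdx e → ℂ :=
  Sum.elim
    (fun d => (if d.1 = Finsupp.single 0 1 then (1 : ℂ) else 0) + (if d.1 = Finsupp.single 2 1 then (2 : ℂ) else 0))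
    (fun d => (if d.1 = Finsupp.single 0 (e - 1) then (1 : ℂ) else 0) +
      (if d.1 = Finsupp.single 2 (e - 1) then (1 / 2 : ℂ) else 0))

/-- `a₀ = 1`. [cite: Kollar2007, §3.3] -/
@[simp] theorem coefLin_fermatParam_zero : coefLin (fermatParam e) 0 = 1 := by
  simp [coefLin, fermatParam, linIdx, Finsupp.single_eq_single_iff]

/-- `a₁ = 0`. [cite: Kollar2007, §3.3] -/
@[simp] theorem coefLin_fermatParam_one : coefLin (fermatParam e) 1 = 0 := by
  simp [coefLin, fermatParam, linIdx, Finsupp.single_eq_single_iff]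

/-- `a₂ = 2`. [cite: Kollar2007, §3.3] -/
@[simp] theorem coefLin_fermatParam_two : coefLin (fermatParam e) 2 = 2 := by
  simp [coefLin, fermatParam, linIdx, Finsupp.single_eq_single_iff]

/-- `a₀² − a₁² = 1` (so the plane-coordinate inverse `dinv` may be taken to be `1`). [cite: Kollar2007, §3.3] -/
theorem det_fermatParam : coefLin (fermatParam e) 0 ^ 2 - coefLin (fermatParam e) 1 ^ 2 = 1 := by
  simp

/-- `(a₀² − a₁²) · 1 = 1` — the hypothesis `hd` of the plane-coordinate files at `dinv = 1`. [cite: Kollar2007, §3.3] -/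
theorem det_fermatParam_mul_one : (coefLin (fermatParam e) 0 ^ 2 - coefLin (fermatParam e) 1 ^ 2) * 1 = 1 := by
  simp

/-- `c* = x₀ + 2x₂`. [cite: Kollar2007, §3.3] -/
theorem cOfR_fermatParam : cOfR (fermatParam e) = X 0 + C 2 * X 2 := by
  rw [cOfR_eq_sum, Fin.sum_univ_three]
  have h0 : fermatParam e (Sum.inl (linIdx 0)) = 1 := coefLin_fermatParam_zero e
  have h1 : fermatParam e (Sum.inl (linIdx 1)) = 0 := coefLin_fermatParam_one e
  have h2 : fermatParam e (Sum.inl (linIdx 2)) = 2 := coefLin_fermatParam_two e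
  rw [h0, h1, h2, map_one, one_mul, map_zero, zero_mul, add_zero]

/-- `ψ₀* = x₀^{e−1} + ½ x₂^{e−1}`. [cite: Kollar2007, §3.3] -/
theorem sum_monomial_fermatParam :
    (∑ d : DegIndex 1 (e - 1), monomial d.1 (fermatParam e (Sum.inr d))) =
      X 0 ^ (e - 1) + C (1 / 2 : ℂ) * X 2 ^ (e - 1) := by
  classical
  have hsplit : ∀ d : DegIndex 1 (e - 1), monomial d.1 (fermatParam e (Sum.inr d)) =
      (if d = ⟨Finsupp.single 0 (e - 1), Finsupp.degree_single _ _⟩ then monomial (Finsupp.single 0 (e - 1)) (1 : ℂ) else 0) +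
      (if d = ⟨Finsupp.single 2 (e - 1), Finsupp.degree_single _ _⟩ then monomial (Finsupp.single 2 (e - 1)) (1 / 2 : ℂ)
        else 0) := by
    intro d
    simp only [fermatParam, Sum.elim_inr, map_add]
    congr 1
    · by_cases h : d.1 = Finsupp.single 0 (e - 1)
      · have hd : d = ⟨Finsupp.single 0 (e - 1), Finsupp.degree_single _ _⟩ := Subtype.ext h
        rw [if_pos h, if_pos hd, h]
      · have hd : d ≠ ⟨Finsupp.single 0 (e - 1), Finsupp.degree_single _ _⟩ := fun h' => h (by rw [h'])
        rw [if_neg h, if_neg hd, map_zero]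
    · by_cases h : d.1 = Finsupp.single 2 (e - 1)
      · have hd : d = ⟨Finsupp.single 2 (e - 1), Finsupp.degree_single _ _⟩ := Subtype.ext h
        rw [if_pos h, if_pos hd, h]
      · have hd : d ≠ ⟨Finsupp.single 2 (e - 1), Finsupp.degree_single _ _⟩ := fun h' => h (by rw [h'])
        rw [if_neg h, if_neg hd, map_zero]
  simp_rw [hsplit]
  rw [Finset.sum_add_distrib, Finset.sum_ite_eq', Finset.sum_ite_eq']
  simp only [Finset.mem_univ, if_true]
  rw [X_pow_eq_monomial, X_pow_eq_monomial, C_mul_monomial, mul_one]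

/-- **`ψ* = x₀^{e−1} + x₁^{e−1} + x₂^{e−1}`** (the Fermat form; symmetric under `x₀ ↔ x₁`). [cite: Kollar2007, §3.3] -/
theorem ψOfR_fermatParam : ψOfR (fermatParam e) = X 0 ^ (e - 1) + X 1 ^ (e - 1) + X 2 ^ (e - 1) := by
  rw [ψOfR, sum_monomial_fermatParam]
  have h0 : rename (Equiv.swap (0 : Fin 3) 1) (X 0 : MvPolynomial (Fin 3) ℂ) = X 1 := by
    rw [rename_X, Equiv.swap_apply_left]
  have h2 : rename (Equiv.swap (0 : Fin 3) 1) (X 2 : MvPolynomial (Fin 3) ℂ) = X 2 := by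
    rw [rename_X, Equiv.swap_apply_of_ne_of_ne (by decide) (by decide)]
  simp only [map_add, map_mul, map_pow, rename_C, h0, h2]
  have hC : (C (1 / 2 : ℂ) : MvPolynomial (Fin 3) ℂ) + C (1 / 2) = 1 := by
    rw [← map_add, show (1 / 2 : ℂ) + 1 / 2 = 1 by norm_num, map_one]
  linear_combination (X 2 ^ (e - 1) : MvPolynomial (Fin 3) ℂ) * hC

/-! ### The plane coordinates of the Fermat member (`dinv = 1`) -/

/-- `u₀(s, y) = s²y − 2`. [cite: Naie2007, §1.2 (normalization procedure) and Example 1] -/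
theorem planeU₀₂_fermatParam : planeU₀₂ (fermatParam e) 1 = X 0 ^ 2 * X 1 - C 2 := by
  simp only [planeU₀₂, coefLin_fermatParam_zero, coefLin_fermatParam_one, coefLin_fermatParam_two, map_one, map_zero]
  ring

/-- `u₁(s, y) = y − 2`. [cite: Naie2007, §1.2 (normalization procedure) and Example 1] -/
theorem planeU₁₂_fermatParam : planeU₁₂ (fermatParam e) 1 = X 1 - C 2 := by
  simp only [planeU₁₂, coefLin_fermatParam_zero, coefLin_fermatParam_one, coefLin_fermatParam_two, map_one, map_zero]
  ring

/-- `A₂ = s²y − y = y(s² − 1)` (the branch lines `α = 0` ↔ `f₁ + f₋₁`, and `E`). [cite: Naie2007, §1.2 (normalization procedure) and Example 1] -/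
theorem planeA₂_fermatParam : planeA₂ (fermatParam e) 1 = X 0 ^ 2 * X 1 - X 1 := by
  rw [planeA₂, planeU₀₂_fermatParam, planeU₁₂_fermatParam]
  ring

/-- **`Ψ₂ = (s²y − 2)^{e−1} + (y − 2)^{e−1} + 1`** — the curve `Ψ̃` of the Fermat member in the chart `(s, y)`.
[cite: Naie2007, §1.2 (normalization procedure) and Example 1] -/
theorem planeΨ₂_fermatParam :
    planeΨ₂ (fermatParam e) 1 = (X 0 ^ 2 * X 1 - C 2) ^ (e - 1) + (X 1 - C 2) ^ (e - 1) + 1 := by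
  rw [planeΨ₂, ψOfR_fermatParam]
  simp only [map_add, map_pow, aeval_X, Matrix.cons_val_zero, Matrix.cons_val_one, Matrix.cons_val_two,
    Matrix.tail_cons, Matrix.head_cons, planeU₀₂_fermatParam, planeU₁₂_fermatParam, one_pow]

/-- **The branch form of the Fermat member**: `G₂ = s · (s²y − y) · Ψ₂ = s(s² − 1)·y·Ψ₂`.
[cite: Zariski1929] [cite: Naie2007, §1.2 (normalization procedure) and Example 1] -/
theorem planeG₂_fermatParam :
    planeG₂ (fermatParam e) 1 =
      X 0 * (X 0 ^ 2 * X 1 - X 1) * ((X 0 ^ 2 * X 1 - C 2) ^ (e - 1) + (X 1 - C 2) ^ (e - 1) + 1) := by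
  rw [planeG₂, planeA₂_fermatParam, planeΨ₂_fermatParam]

/-- The branch form, factorised: `G₂ = (s · (s − 1) · (s + 1)) · y · Ψ₂`. [cite: Zariski1929] -/
theorem planeG₂_fermatParam_factor :
    planeG₂ (fermatParam e) 1 =
      (X 0 * (X 0 - 1) * (X 0 + 1)) * X 1 * ((X 0 ^ 2 * X 1 - C 2) ^ (e - 1) + (X 1 - C 2) ^ (e - 1) + 1) := by
  rw [planeG₂_fermatParam]
  ring

/-! ### First hand check: `Ψ̃` misses `E = {y = 0}` -/

/-- `Ψ₂(s, y)` at a point. [cite: Naie2007, §1.2 (normalization procedure) and Example 1] -/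
theorem eval_planeΨ₂_fermatParam (p : Fin 2 → ℂ) :
    MvPolynomial.eval p (planeΨ₂ (fermatParam e) 1) = (p 0 ^ 2 * p 1 - 2) ^ (e - 1) + (p 1 - 2) ^ (e - 1) + 1 := by
  rw [planeΨ₂_fermatParam]
  simp only [map_add, map_pow, map_sub, map_mul, eval_X, eval_C, map_one]

/-- **`Ψ₂(s, 0) = 1 − 2^e ≠ 0` for `e ≥ 1` with `e − 1` odd** (i.e. `e` even, `e ≥ 2`): the curve `Ψ̃` of the Fermat member
does not meet `E = {y = 0}` — no triple points on `E`, and `E ⋔`-conditions are vacuous. [cite: Zariski1929] -/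
theorem eval_planeΨ₂_fermatParam_ne_zero_of_y_eq_zero {e : ℕ} (he : Odd (e - 1)) (p : Fin 2 → ℂ) (hp : p 1 = 0) :
    MvPolynomial.eval p (planeΨ₂ (fermatParam e) 1) ≠ 0 := by
  rw [eval_planeΨ₂_fermatParam, hp, mul_zero, zero_sub, he.neg_pow]
  -- value: `-2^(e-1) - 2^(e-1) + 1 = 1 - 2^e`
  intro h
  have h2 : (2 : ℂ) ^ (e - 1) * 2 = 1 := by linear_combination -h
  have h3 : ((2 ^ (e - 1) * 2 : ℕ) : ℂ) = ((1 : ℕ) : ℂ) := by push_cast; exact h2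
  have h4 : 2 ^ (e - 1) * 2 = 1 := by exact_mod_cast h3
  have h5 : 1 ≤ 2 ^ (e - 1) := Nat.one_le_two_pow
  omega

end Literature.AlgebraicGeometry.HodgeTheory.Q8Family

end
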